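/-
Origin: expansion seat `planner-pub-hodgecm-pv05-g3-0`, handover #2 2026-08-18T05:40:47Z (`HOME/pub-hodgecm-pv05-g3/lean/Pv05g3/FockGL3.lean`, md5 85cb2d56, 391 lines);
landed by the gen-6 packager in gate run 23 as `HodgeCM/PerL34/FockGL3.lean` (import ^import Pv[0-9]+g[0-9]+\.→import HodgeCM.PerL34. ×1).
-/
/-
Origin: HOME/pub-hodgecm-pv05-g3/lean/Pv05g3/FockGL3.lean — session planner-pub-hodgecm-pv05-g3-0 (unit pub-hodgecm-pv05-g3,
DAG-node prover #05 gen 3).  Intended final place: `HodgeCM/PerL34/FockGL3.lean` (namespace `HodgeCM.PerL34.Fock`).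
Imports this seat's `FockIrreducible` (PACKAGER: rewrite `import Pv05g3.FockIrreducible` to `import HodgeCM.PerL34.FockIrreducible`)
and Mathlib only; asserts nothing.
-/
import Mathlib.Algebra.Lie.OfAssociative
import Mathlib.LinearAlgebra.Matrix.StdBasis
import Mathlib.LinearAlgebra.Basis.Bilinear
import Summits.HodgeConjecture.HodgeCM.PerL34.FockIrreducible_4

set_option autoImplicit false

/-!
# The nine operators form the oscillator representation of `𝔤𝔩₃(ℂ) = 𝔲(2,1)_ℂ` on `ℂ[z₁, z₂, w]`

`FockIrreducible` proved Howe duality for the one-line Fock shell in terms of NINE explicit operators on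
`HarmModel = ℂ[z₁, z₂, w]` (`hE a b = z_a∂_{z_b}`, `hH = w∂_w`, `hP a = z_a w`, `hQ a = ∂_{z_a}∂_w`) and asserted in
prose that they span the image of `𝔤′ = 𝔲(2,1)_ℂ = 𝔤𝔩₃(ℂ)`.  This file KERNEL-CHECKS that assertion at the Lie-algebra
level, with complete proofs and no hypotheses:

* `osc i j` (`i j : HarmVar`, a basis `v₁, v₂` of `V⁺` and `v₃ = w` of `V⁻`): the oscillator images of the matrix units
  `E_{ij}` — `E_{ab} ↦ z_a∂_{z_b} + δ_{ab}`, `E_{33} ↦ −w∂_w`, `E_{a3} ↦ z_a w` (`𝔭′⁺`), `E_{3a} ↦ −∂_{z_a}∂_w` (`𝔭′⁻`);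
* **`osc_comm` / `osc_lie`**: all `81` relations `[osc_{ij}, osc_{kl}] = δ_{jk} osc_{il} − δ_{li} osc_{kj}` (the second
  Weyl-algebra computation is done by `simp` + `ring` after normal-ordering mixed partials, `pderiv_pderiv_comm`);
* **`oscRep : Matrix HarmVar HarmVar ℂ →ₗ⁅ℂ⁆ Module.End ℂ HarmModel`**, the resulting Lie algebra homomorphism
  `𝔤𝔩₃(ℂ) → End(ℂ[z₁,z₂,w])` (`oscRep_single : oscRep (E_{ij}) = osc i j`), obtained from `osc_comm` by bilinear
  extension over the standard basis (`LinearMap.ext_basis`);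
* **`oscRep_mem_hpiece`**: `oscRep (𝔤𝔩₃)` commutes with the `U(1)_W`-grading, i.e. preserves every `F_k = hpiece k`;
  **`isGStable_iff_oscRep`**: pv05-g3's `IsGStable` = stability under all of `oscRep (𝔤𝔩₃)`; hence
  **`hpiece_le_of_oscRep_stable` / `hpiece_isGeneratedBy_oscRep`**: each `F_k` is an IRREDUCIBLE `𝔤𝔩₃(ℂ)`-module
  (FockIrreducible's theorem, now literally about a Lie algebra representation), and `isHarm_iff_osc`: the harmonics
  are the joint kernel of `oscRep (𝔭′⁻)`;
* the definite pair: **`dE_comm`, `dERep : Matrix (Fin 3) (Fin 3) ℂ →ₗ⁅ℂ⁆ Module.End ℂ DefModel`** (polarisation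
  representation `E_{ab} ↦ z_a∂_{z_b}` of `𝔤𝔩₃ = 𝔲(3)_ℂ` on `ℂ[z₁,z₂,z₃]`) and **`dpiece_le_of_dERep_stable`**
  (`Sym^d ℂ³` irreducible).

NORMALISATION.  The integral shifts (`+δ_{ab}` on the `𝔤𝔩₂` block, none on `E_{33}`) differ from the genuine
`K̃′`-normalisation of the Fock model (`z_a∂_{z_b} + ½δ_{ab}`, `−w∂_w − ½`; cf. the half-integral labels
`(a+½, ½) ⊗ (−½)` in FockIrreducible's docstring) by the central character `½·tr` of `𝔤𝔩₃`; commutation relations and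
invariant subspaces are unaffected, and any shift `(c₁, c₂)` with `c₁ + c₂ = 1` would do (`osc_comm` forces exactly
this: `[−∂_a∂_w, z_a w] = −(z_a∂_a + w∂_w + 1)`).

PROVENANCE (orientation only — this file cites nothing and asserts nothing): the realisation of `𝔤𝔩(V_ℂ) ⊂ 𝔰𝔭(W)_ℂ`
by degree-two elements of the Weyl algebra (polynomial-coefficient differential operators) on the Fock space is the
standard one of R. Howe, Remarks on classical invariant theory, Trans. AMS 313 (1989), and of M. Kashiwara – M. Vergne,
Invent. Math. 44 (1978) (not held in the cell corpus; no locator claimed); the `U(p,q) × U(r,s)` bookkeeping used by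
`FockKTypes` / `FockIrreducible` is that of J. Adams, The theta correspondence over ℝ (2007) §§4–6 (held:
`book:li2007-harmonic-analysis-group-representations-automorphic-forms-invariant`, PDF pp. 9–13, 23).  The comparison
of `osc` with those printed formulas, entry by entry, is DICTIONARY item (i) of GAPS `pv05g3-K1` and is not made here.

PACKAGER: (1) rewrite `import Pv05g3.FockIrreducible` ↦ `import HodgeCM.PerL34.FockIrreducible`; (2) this file uses
`attribute [local instance 100] LieRing.ofAssociativeRing` exactly as `Mathlib.Algebra.Lie.Matrix` does (the
commutator Lie ring on an associative ring is not a global Mathlib instance); it is file-local and adds no axiom.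
-/

namespace HodgeCM

namespace PerL34

namespace Fock

open MvPolynomial Finsupp

open scoped BigOperators

/- As in `Mathlib.Algebra.Lie.Matrix` / `Mathlib.Algebra.Lie.Classical`: the commutator Lie ring structure on an
associative ring (here on `Matrix _ _ ℂ` and on `Module.End ℂ _`) is a non-global Mathlib instance, switched on
locally.  Files using `oscRep` / `dERep` need the same line. -/
attribute [local instance 100] LieRing.ofAssociativeRing

section GL3

/-! ## 1. Mixed partial derivatives commute (normal-ordering lemmas) -/

/-- (Ported verbatim from the HodgeCMPerL package; no docstring in the source.) -/
theorem pderiv_pderiv_comm {σ : Type*} (i j : σ) (f : MvPolynomial σ ℂ) :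
    pderiv i (pderiv j f) = pderiv j (pderiv i f) := by
  classical
  ext m
  simp only [coeff_pderiv]
  by_cases hij : i = j
  · rw [hij]
  · rw [add_right_comm m (single i 1) (single j 1), Finsupp.add_apply, Finsupp.add_apply, single_apply,
      single_apply, if_neg hij, if_neg (Ne.symm hij), add_zero, add_zero]
    ring

/-- (Ported verbatim from the HodgeCMPerL package; no docstring in the source.) -/
@[simp] theorem pderiv_10_comm (f : HarmModel) :
    pderiv (Sum.inl 1) (pderiv (Sum.inl 0) f) = pderiv (Sum.inl 0) (pderiv (Sum.inl 1) f) :=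
  pderiv_pderiv_comm _ _ f

/-- (Ported verbatim from the HodgeCMPerL package; no docstring in the source.) -/
@[simp] theorem pderiv_w0_comm (f : HarmModel) :
    pderiv (Sum.inr ()) (pderiv (Sum.inl 0) f) = pderiv (Sum.inl 0) (pderiv (Sum.inr ()) f) :=
  pderiv_pderiv_comm _ _ f

/-- (Ported verbatim from the HodgeCMPerL package; no docstring in the source.) -/
@[simp] theorem pderiv_w1_comm (f : HarmModel) :
    pderiv (Sum.inr ()) (pderiv (Sum.inl 1) f) = pderiv (Sum.inl 1) (pderiv (Sum.inr ()) f) :=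
  pderiv_pderiv_comm _ _ f

/-! ## 2. The oscillator realisation of the matrix units of `𝔤𝔩₃` -/

/-- The images of the matrix units `E_{ij}` (`i, j ∈ HarmVar = {z₁, z₂} ⊔ {w}`, i.e. a basis `v₁, v₂` of `V⁺` and `v₃`
of `V⁻`) under the oscillator (Fock-model) realisation of `𝔤𝔩(V_ℂ) = 𝔤𝔩₃`: the `𝔨′ = 𝔤𝔩₂ ⊕ 𝔤𝔩₁` block by
`E_{ab} ↦ z_a ∂_{z_b} + δ_{ab}`, `E_{33} ↦ −w ∂_w`; `𝔭′⁺ : E_{a3} ↦ z_a w`; `𝔭′⁻ : E_{3a} ↦ −∂_{z_a} ∂_w`.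
(Integral normalisation = Adams's genuine `K̃′`-normalisation `z_a∂_b + ½δ_{ab}`, `−w∂_w − ½` twisted by the central
character `½·tr`; brackets are unaffected.) -/
noncomputable def osc : HarmVar → HarmVar → Module.End ℂ HarmModel
  | Sum.inl a, Sum.inl b => hE a b + (if a = b then 1 else 0)
  | Sum.inr _, Sum.inr _ => -hH
  | Sum.inl a, Sum.inr _ => hP a
  | Sum.inr _, Sum.inl a => -hQ a

/-- **The `𝔤𝔩₃` commutation relations**: `[osc_{ij}, osc_{kl}] = δ_{jk} osc_{il} − δ_{li} osc_{kj}`. -/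
theorem osc_comm (i j k l : HarmVar) :
    osc i j * osc k l - osc k l * osc i j = (if j = k then osc i l else 0) - (if l = i then osc k j else 0) := by
  apply LinearMap.ext
  intro f
  rcases i with i | ⟨⟩ <;> rcases j with j | ⟨⟩ <;> rcases k with k | ⟨⟩ <;> rcases l with l | ⟨⟩ <;>
    (try fin_cases i) <;> (try fin_cases j) <;> (try fin_cases k) <;> (try fin_cases l) <;>
    simp [osc, hE_apply, hH_apply, hP_apply, hQ_apply, hz, hw] <;> ring


/-- (Ported verbatim from the HodgeCMPerL package; no docstring in the source.) -/
theorem osc_lie (i j k l : HarmVar) :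
    ⁅osc i j, osc k l⁆ = (if j = k then osc i l else 0) - (if l = i then osc k j else 0) := by
  rw [LieRing.of_associative_ring_bracket, osc_comm]

/-- `𝔭′⁺` and `𝔭′⁻` are abelian, `𝔨′` normalises them: the special cases most used. -/
theorem osc_pPlus_comm (a b : Fin 2) :
    osc (Sum.inl a) (Sum.inr ()) * osc (Sum.inl b) (Sum.inr ()) =
      osc (Sum.inl b) (Sum.inr ()) * osc (Sum.inl a) (Sum.inr ()) := by
  have h := osc_comm (Sum.inl a) (Sum.inr ()) (Sum.inl b) (Sum.inr ())
  simp only [reduceCtorEq, if_false, sub_self, sub_eq_zero] at h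
  exact h

/-- (Ported verbatim from the HodgeCMPerL package; no docstring in the source.) -/
theorem osc_pMinus_comm (a b : Fin 2) :
    osc (Sum.inr ()) (Sum.inl a) * osc (Sum.inr ()) (Sum.inl b) =
      osc (Sum.inr ()) (Sum.inl b) * osc (Sum.inr ()) (Sum.inl a) := by
  have h := osc_comm (Sum.inr ()) (Sum.inl a) (Sum.inr ()) (Sum.inl b)
  simp only [reduceCtorEq, if_false, sub_self, sub_eq_zero] at h
  exact h

/-! ## 3. The Lie algebra homomorphism `𝔤𝔩₃(ℂ) → End(ℂ[z₁,z₂,w])` -/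

/-- Linear extension of `osc` to all of `𝔤𝔩₃ = Matrix HarmVar HarmVar ℂ`. -/
noncomputable def oscLin : Matrix HarmVar HarmVar ℂ →ₗ[ℂ] Module.End ℂ HarmModel where
  toFun A := ∑ i, ∑ j, A i j • osc i j
  map_add' A B := by
    simp only [Matrix.add_apply, add_smul, Finset.sum_add_distrib]
  map_smul' c A := by
    simp only [Matrix.smul_apply, smul_eq_mul, mul_smul, RingHom.id_apply, Finset.smul_sum]

/-- (Ported verbatim from the HodgeCMPerL package; no docstring in the source.) -/
theorem oscLin_apply (A : Matrix HarmVar HarmVar ℂ) : oscLin A = ∑ i, ∑ j, A i j • osc i j := rfl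

/-- (Ported verbatim from the HodgeCMPerL package; no docstring in the source.) -/
theorem oscLin_single (i j : HarmVar) (c : ℂ) : oscLin (Matrix.single i j c) = c • osc i j := by
  rw [oscLin_apply, Finset.sum_eq_single i, Finset.sum_eq_single j]
  · rw [Matrix.single_apply_same]
  · intro j' _ hj'
    rw [Matrix.single_apply_of_ne, zero_smul]
    exact fun h => hj' h.2.symm
  · intro h; exact absurd (Finset.mem_univ j) h
  · intro i' _ hi'
    refine Finset.sum_eq_zero fun j' _ => ?_
    rw [Matrix.single_apply_of_ne, zero_smul]
    exact fun h => hi' h.1.symm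
  · intro h; exact absurd (Finset.mem_univ i) h

/-- **The oscillator representation of `𝔤𝔩₃(ℂ) = 𝔲(2,1)_ℂ` on the one-line Fock model `ℂ[z₁,z₂,w]`** is a Lie algebra
homomorphism (kernel-checked on all `81` pairs of matrix units via `osc_comm`). -/
noncomputable def oscRep : Matrix HarmVar HarmVar ℂ →ₗ⁅ℂ⁆ Module.End ℂ HarmModel :=
  { oscLin with
    map_lie' := by
      intro A B
      let L₁ : Matrix HarmVar HarmVar ℂ →ₗ[ℂ] Matrix HarmVar HarmVar ℂ →ₗ[ℂ] Module.End ℂ HarmModel :=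
        LinearMap.mk₂ ℂ (fun A B => oscLin ⁅A, B⁆) (fun A₁ A₂ B => by rw [add_lie, map_add])
          (fun c A B => by rw [smul_lie, map_smul]) (fun A B₁ B₂ => by rw [lie_add, map_add])
          (fun c A B => by rw [lie_smul, map_smul])
      let L₂ : Matrix HarmVar HarmVar ℂ →ₗ[ℂ] Matrix HarmVar HarmVar ℂ →ₗ[ℂ] Module.End ℂ HarmModel :=
        LinearMap.mk₂ ℂ (fun A B => ⁅oscLin A, oscLin B⁆) (fun A₁ A₂ B => by rw [map_add, add_lie])
          (fun c A B => by
            simp only [map_smul, LieRing.of_associative_ring_bracket, smul_sub, smul_mul_assoc, mul_smul_comm])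
          (fun A B₁ B₂ => by rw [map_add, lie_add])
          (fun c A B => by
            simp only [map_smul, LieRing.of_associative_ring_bracket, smul_sub, smul_mul_assoc, mul_smul_comm])
      have key : L₁ = L₂ := by
        refine LinearMap.ext_basis (Matrix.stdBasis ℂ HarmVar HarmVar) (Matrix.stdBasis ℂ HarmVar HarmVar)
          fun p q => ?_
        obtain ⟨i, j⟩ := p
        obtain ⟨k, l⟩ := q
        simp only [L₁, L₂, LinearMap.mk₂_apply, Matrix.stdBasis_eq_single, LieRing.of_associative_ring_bracket,
          map_sub, oscLin_single, one_smul, osc_comm]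
        by_cases hjk : j = k
        · subst hjk
          by_cases hli : l = i
          · subst hli
            simp [oscLin_single]
          · rw [Matrix.single_mul_single_same, Matrix.single_mul_single_of_ne (h := hli), if_neg hli]
            simp [oscLin_single]
        · by_cases hli : l = i
          · subst hli
            rw [Matrix.single_mul_single_same, Matrix.single_mul_single_of_ne (h := hjk), if_neg hjk]
            simp [oscLin_single]
          · rw [Matrix.single_mul_single_of_ne (h := hjk), Matrix.single_mul_single_of_ne (h := hli), if_neg hjk,
              if_neg hli]
            simp
      exact LinearMap.congr_fun₂ key A B }

/-- (Ported verbatim from the HodgeCMPerL package; no docstring in the source.) -/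
theorem oscRep_apply (A : Matrix HarmVar HarmVar ℂ) : oscRep A = ∑ i, ∑ j, A i j • osc i j := rfl

/-- (Ported verbatim from the HodgeCMPerL package; no docstring in the source.) -/
theorem oscRep_single (i j : HarmVar) : oscRep (Matrix.single i j (1 : ℂ)) = osc i j := by
  change oscLin _ = _
  rw [oscLin_single, one_smul]

/-! ## 4. `U(1)`-equivariance and the link with irreducibility -/

/-- Every `oscRep A` commutes with the `U(1)_W`-grading: it preserves each `F_k`. -/
theorem osc_mem_hpiece (k : ℤ) (i j : HarmVar) : ∀ f ∈ hpiece k, osc i j f ∈ hpiece k := by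
  intro f hf
  rcases i with a | ⟨⟩ <;> rcases j with b | ⟨⟩
  · change hE a b f + (if a = b then (1 : Module.End ℂ HarmModel) else 0) f ∈ hpiece k
    refine Submodule.add_mem _ (hpiece_map_mem k (.E a b) f hf) ?_
    split_ifs
    · exact hf
    · exact Submodule.zero_mem _
  · exact hpiece_map_mem k (.P a) f hf
  · exact Submodule.neg_mem _ (hpiece_map_mem k (.Q b) f hf)
  · exact Submodule.neg_mem _ (hpiece_map_mem k .H f hf)

/-- (Ported verbatim from the HodgeCMPerL package; no docstring in the source.) -/
theorem oscRep_mem_hpiece (k : ℤ) (A : Matrix HarmVar HarmVar ℂ) : ∀ f ∈ hpiece k, oscRep A f ∈ hpiece k := by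
  intro f hf
  rw [oscRep_apply, LinearMap.sum_apply]
  refine Submodule.sum_mem _ fun i _ => ?_
  rw [LinearMap.sum_apply]
  refine Submodule.sum_mem _ fun j _ => ?_
  rw [LinearMap.smul_apply]
  exact Submodule.smul_mem _ _ (osc_mem_hpiece k i j f hf)

/-- Stability under the nine operators = stability under all of `oscRep (𝔤𝔩₃)`. -/
theorem isGStable_iff_oscRep (M : Submodule ℂ HarmModel) :
    IsGStable M ↔ ∀ A : Matrix HarmVar HarmVar ℂ, ∀ f ∈ M, oscRep A f ∈ M := by
  constructor
  · intro hM A f hf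
    have hosc : ∀ i j, osc i j f ∈ M := by
      rintro (a | ⟨⟩) (b | ⟨⟩)
      · change hE a b f + (if a = b then (1 : Module.End ℂ HarmModel) else 0) f ∈ M
        refine M.add_mem (hM.1.1 a b f hf) ?_
        split_ifs
        · exact hf
        · exact M.zero_mem
      · exact hM.2.1 a f hf
      · exact M.neg_mem (hM.2.2 b f hf)
      · exact M.neg_mem (hM.1.2 f hf)
    rw [oscRep_apply, LinearMap.sum_apply]
    refine Submodule.sum_mem _ fun i _ => ?_
    rw [LinearMap.sum_apply]
    refine Submodule.sum_mem _ fun j _ => ?_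
    rw [LinearMap.smul_apply]
    exact M.smul_mem _ (hosc i j)
  · intro h
    have hosc : ∀ i j, ∀ f ∈ M, osc i j f ∈ M := fun i j f hf => by
      rw [← oscRep_single]; exact h _ f hf
    refine ⟨⟨fun a b f hf => ?_, fun f hf => ?_⟩, fun a f hf => hosc (.inl a) (.inr ()) f hf, fun a f hf => ?_⟩
    · have h1 := hosc (.inl a) (.inl b) f hf
      change hE a b f + (if a = b then (1 : Module.End ℂ HarmModel) else 0) f ∈ M at h1
      split_ifs at h1
      · have h2 := M.sub_mem h1 hf
        rwa [Module.End.one_apply, add_sub_cancel_right] at h2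
      · rwa [LinearMap.zero_apply, add_zero] at h1
    · have h1 := hosc (.inr ()) (.inr ()) f hf
      change (-hH) f ∈ M at h1
      rw [LinearMap.neg_apply] at h1
      simpa using M.neg_mem h1
    · have h1 := hosc (.inr ()) (.inl a) f hf
      change (-hQ a) f ∈ M at h1
      rw [LinearMap.neg_apply] at h1
      simpa using M.neg_mem h1

/-- **Irreducibility restated on `𝔤𝔩₃(ℂ)`** (FockIrreducible `hpiece_le_of_isGStable`): every `F_k` is an
IRREDUCIBLE `𝔤𝔩₃(ℂ)`-submodule of `ℂ[z₁,z₂,w]` under `oscRep` — an `oscRep`-stable subspace meeting `F_k` non-trivially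
contains `F_k`. -/
theorem hpiece_le_of_oscRep_stable (k : ℤ) (M : Submodule ℂ HarmModel)
    (hM : ∀ A : Matrix HarmVar HarmVar ℂ, ∀ f ∈ M, oscRep A f ∈ M) {v : HarmModel} (hvM : v ∈ M) (hv : v ≠ 0)
    (hvk : v ∈ hpiece k) : hpiece k ≤ M :=
  hpiece_le_of_isGStable k M ((isGStable_iff_oscRep M).mpr hM) hvM hv hvk

/-- (Ported verbatim from the HodgeCMPerL package; no docstring in the source.) -/
theorem hpiece_isGeneratedBy_oscRep (k : ℤ) {v : HarmModel} (hvk : v ∈ hpiece k) (hv : v ≠ 0) :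
    IsGeneratedBy (fun A : Matrix HarmVar HarmVar ℂ => (oscRep A : Module.End ℂ HarmModel).restrict
      (oscRep_mem_hpiece k A)) (⟨v, hvk⟩ : ↥(hpiece k)) :=
  isGeneratedBy_restrict (hpiece k) (fun A => (oscRep A : Module.End ℂ HarmModel)) (oscRep_mem_hpiece k) hvk
    fun S hvS hS => hpiece_le_of_oscRep_stable k S hS hvS hv hvk

/-- The harmonics are the joint kernel of `oscRep (𝔭′⁻)`. -/
theorem isHarm_iff_osc (f : HarmModel) : IsHarm f ↔ ∀ a : Fin 2, osc (Sum.inr ()) (Sum.inl a) f = 0 := by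
  refine forall_congr' fun a => ?_
  change _ ↔ (-hQ a) f = 0
  rw [LinearMap.neg_apply, neg_eq_zero]

end GL3

/-! ## 5. The definite pair: the polarisation representation of `𝔤𝔩₃(ℂ) = 𝔲(3)_ℂ` on `ℂ[z₁, z₂, z₃]` -/

section GL3Def

/-- (Ported verbatim from the HodgeCMPerL package; no docstring in the source.) -/
theorem dE_comm (a b c d : Fin 3) :
    dE a b * dE c d - dE c d * dE a b = (if b = c then dE a d else 0) - (if d = a then dE c b else 0) := by
  apply LinearMap.ext
  intro f
  have hc : ∀ (i j : Fin 3) (g : DefModel), pderiv i (pderiv j g) = pderiv j (pderiv i g) :=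
    fun i j g => pderiv_pderiv_comm i j g
  fin_cases a <;> fin_cases b <;> fin_cases c <;> fin_cases d <;>
    simp [dE_apply, hc 1 0, hc 2 0, hc 2 1] <;> ring

/-- Linear extension of `dE`. -/
noncomputable def dELin : Matrix (Fin 3) (Fin 3) ℂ →ₗ[ℂ] Module.End ℂ DefModel where
  toFun A := ∑ i, ∑ j, A i j • dE i j
  map_add' A B := by
    simp only [Matrix.add_apply, add_smul, Finset.sum_add_distrib]
  map_smul' c A := by
    simp only [Matrix.smul_apply, smul_eq_mul, mul_smul, RingHom.id_apply, Finset.smul_sum]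

/-- (Ported verbatim from the HodgeCMPerL package; no docstring in the source.) -/
theorem dELin_single (i j : Fin 3) (c : ℂ) : dELin (Matrix.single i j c) = c • dE i j := by
  change (∑ i', ∑ j', (Matrix.single i j c) i' j' • dE i' j') = _
  rw [Finset.sum_eq_single i, Finset.sum_eq_single j]
  · rw [Matrix.single_apply_same]
  · intro j' _ hj'
    rw [Matrix.single_apply_of_ne, zero_smul]
    exact fun h => hj' h.2.symm
  · intro h; exact absurd (Finset.mem_univ j) h
  · intro i' _ hi'
    refine Finset.sum_eq_zero fun j' _ => ?_
    rw [Matrix.single_apply_of_ne, zero_smul]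
    exact fun h => hi' h.1.symm
  · intro h; exact absurd (Finset.mem_univ i) h

/-- **The polarisation representation `E_{ab} ↦ z_a ∂_{z_b}` of `𝔤𝔩₃(ℂ) = 𝔲(3)_ℂ` on `ℂ[z₁,z₂,z₃]`** is a Lie
algebra homomorphism; its invariant pieces `Sym^d` are irreducible (FockIrreducible `dpiece_le_of_stable`). -/
noncomputable def dERep : Matrix (Fin 3) (Fin 3) ℂ →ₗ⁅ℂ⁆ Module.End ℂ DefModel :=
  { dELin with
    map_lie' := by
      intro A B
      let L₁ : Matrix (Fin 3) (Fin 3) ℂ →ₗ[ℂ] Matrix (Fin 3) (Fin 3) ℂ →ₗ[ℂ] Module.End ℂ DefModel :=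
        LinearMap.mk₂ ℂ (fun A B => dELin ⁅A, B⁆) (fun A₁ A₂ B => by rw [add_lie, map_add])
          (fun c A B => by rw [smul_lie, map_smul]) (fun A B₁ B₂ => by rw [lie_add, map_add])
          (fun c A B => by rw [lie_smul, map_smul])
      let L₂ : Matrix (Fin 3) (Fin 3) ℂ →ₗ[ℂ] Matrix (Fin 3) (Fin 3) ℂ →ₗ[ℂ] Module.End ℂ DefModel :=
        LinearMap.mk₂ ℂ (fun A B => ⁅dELin A, dELin B⁆) (fun A₁ A₂ B => by rw [map_add, add_lie])
          (fun c A B => by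
            simp only [map_smul, LieRing.of_associative_ring_bracket, smul_sub, smul_mul_assoc, mul_smul_comm])
          (fun A B₁ B₂ => by rw [map_add, lie_add])
          (fun c A B => by
            simp only [map_smul, LieRing.of_associative_ring_bracket, smul_sub, smul_mul_assoc, mul_smul_comm])
      have key : L₁ = L₂ := by
        refine LinearMap.ext_basis (Matrix.stdBasis ℂ (Fin 3) (Fin 3)) (Matrix.stdBasis ℂ (Fin 3) (Fin 3))
          fun p q => ?_
        obtain ⟨i, j⟩ := p
        obtain ⟨k, l⟩ := q
        simp only [L₁, L₂, LinearMap.mk₂_apply, Matrix.stdBasis_eq_single, LieRing.of_associative_ring_bracket,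
          map_sub, dELin_single, one_smul, dE_comm]
        by_cases hjk : j = k
        · subst hjk
          by_cases hli : l = i
          · subst hli
            simp [dELin_single]
          · rw [Matrix.single_mul_single_same, Matrix.single_mul_single_of_ne (h := hli), if_neg hli]
            simp [dELin_single]
        · by_cases hli : l = i
          · subst hli
            rw [Matrix.single_mul_single_same, Matrix.single_mul_single_of_ne (h := hjk), if_neg hjk]
            simp [dELin_single]
          · rw [Matrix.single_mul_single_of_ne (h := hjk), Matrix.single_mul_single_of_ne (h := hli), if_neg hjk,
              if_neg hli]
            simp
      exact LinearMap.congr_fun₂ key A B }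

/-- (Ported verbatim from the HodgeCMPerL package; no docstring in the source.) -/
theorem dERep_single (i j : Fin 3) : dERep (Matrix.single i j (1 : ℂ)) = dE i j := by
  change dELin _ = _
  rw [dELin_single, one_smul]

/-- (Ported verbatim from the HodgeCMPerL package; no docstring in the source.) -/
theorem dERep_apply (A : Matrix (Fin 3) (Fin 3) ℂ) : dERep A = ∑ i, ∑ j, A i j • dE i j := rfl

/-- `Sym^d(ℂ³)` is an IRREDUCIBLE `𝔤𝔩₃(ℂ)`-submodule under `dERep`. -/
theorem dpiece_le_of_dERep_stable (d : ℕ) (M : Submodule ℂ DefModel)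
    (hM : ∀ A : Matrix (Fin 3) (Fin 3) ℂ, ∀ f ∈ M, dERep A f ∈ M) {v : DefModel} (hvM : v ∈ M) (hv : v ≠ 0)
    (hvd : v ∈ dpiece d) : dpiece d ≤ M :=
  dpiece_le_of_stable d M (fun a b f hf => by rw [← dERep_single]; exact hM _ f hf) hvM hv hvd

end GL3Def

end Fock

end PerL34

end HodgeCM
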